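import Mathlib
import Literature.Analysis.Complex.CauchyPompeiu
import Literature.Analysis.Complex.SimilarityLiouville

/-!
# Decaying solutions of the triangular conjugated linearised equation vanish
(stub `helper_decayingKernelZero`, line Sketch)

Crux `stmt-SmoothPoincare4-7826` (`TameOrBrodyR4`), line `Sketch`. In the crux's implicit function
theorem the linearised, frame-conjugated Cauchy–Riemann operator along a pencil member acts on
`ℂ²`-valued functions on `ℂ` as `w ↦ 2 ∂̄ w + S w` (`∂̄ = Literature.Analysis.Complex.dbarAlong 1`),
with `S : ℂ → End_ℝ(ℂ²)` smooth, bounded, supported in a disc and UPPER TRIANGULAR (`S ξ` kills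
the tangent column `(y₁, 0)`). Injectivity of the linearisation on functions decaying at infinity
is the statement proved here: a smooth solution `w` of `2 ∂̄ w + S w = 0` with `w → 0` at infinity
vanishes.

Proof: by triangularity `S ξ (w ξ) = S ξ (0, w₂ ξ)`, so the second component `w₂` satisfies the
scalar equation `∂̄ w₂ = r₂` with `r₂ = -½ (S ξ (0, w₂)).2`, `‖r₂‖ ≤ (M/2) ‖w₂‖`, `r₂` supported
in the disc and `w₂ → 0`; the Liouville theorem of the similarity principle
(`Literature.Analysis.Complex.eq_zero_of_dbar_le_of_tendsto_zero`) gives `w₂ = 0`. Then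
`∂̄ w₁ = -½ (S ξ (0, 0)).1 = 0`, so `w₁` is an entire function tending to `0`, hence `0` (the same
theorem with `r = 0`, `M = 0`).
-/

-- the registered namespace `Summit.SmoothPoincare4.SmoothPoincare4.…` repeats a component
set_option linter.dupNamespace false

noncomputable section

open scoped ContDiff Topology
open Filter Set Metric
open Literature.Analysis.Complex

namespace Summit.SmoothPoincare4.SmoothPoincare4.Cruxes.TameOrBrodyR4.Sketch

namespace DecayingKernelZero

/-- An upper-triangular operator on `ℂ × ℂ` (one killing the column `(y₁, 0)`) only sees the
second component: `T p = T (0, p.2)`. -/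
theorem apply_eq_apply_zero_snd (T : (ℂ × ℂ) →L[ℝ] (ℂ × ℂ)) (htri : ∀ y₁ : ℂ, T (y₁, 0) = 0)
    (p : ℂ × ℂ) : T p = T (0, p.2) := by
  conv_lhs => rw [← Prod.fst_add_snd p]
  rw [map_add, htri, zero_add]

/-- In the sup-norm product, `‖(0, c)‖ = ‖c‖`. -/
theorem norm_zero_mk (c : ℂ) : ‖((0 : ℂ), c)‖ = ‖c‖ := by
  simp [Prod.norm_def]

/-- From `2 • D + T = 0` to `D = -(½ • T)`. -/
theorem eq_neg_half_smul {D T : ℂ × ℂ} (h : (2 : ℂ) • D + T = 0) : D = -((2 : ℂ)⁻¹ • T) := by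
  have h2 : D = (2 : ℂ)⁻¹ • ((2 : ℂ) • D) := by
    rw [smul_smul, inv_mul_cancel₀ two_ne_zero, one_smul]
  rw [h2, eq_neg_of_add_eq_zero_left h, smul_neg]

end DecayingKernelZero

open DecayingKernelZero in
/-- **Stub `helper_decayingKernelZero` (INJ).** Let `S : ℂ → ((ℂ × ℂ) →L[ℝ] (ℂ × ℂ))` be smooth,
vanishing where `ρ ≤ ‖ξ‖`, bounded by `M`, and upper triangular (`S ξ (y₁, 0) = 0`). A smooth
`w : ℂ → ℂ × ℂ` with `2 ∂̄ w + S w = 0` and `w → 0` at infinity vanishes identically: the second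
component solves a scalar equation `∂̄ w₂ = r₂`, `‖r₂‖ ≤ (M/2) ‖w₂‖`, `r₂` compactly supported, so
`w₂ = 0` by the Liouville theorem of the similarity principle; then `∂̄ w₁ = 0` and `w₁ → 0`, so
`w₁ = 0` as well. -/
theorem helper_decayingKernelZero (S : ℂ → (ℂ × ℂ) →L[ℝ] (ℂ × ℂ)) (ρ M : ℝ)
    (hSs : ContDiff ℝ ∞ S) (hS : ∀ ξ, ρ ≤ ‖ξ‖ → S ξ = 0) (hM : ∀ ξ, ‖S ξ‖ ≤ M)
    (htri : ∀ ξ (y₁ : ℂ), S ξ (y₁, 0) = 0) (w : ℂ → ℂ × ℂ) (hw : ContDiff ℝ ∞ w)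
    (heq : ∀ ξ, (2 : ℂ) • Literature.Analysis.Complex.dbarAlong (1 : ℂ) w ξ + S ξ (w ξ) = 0)
    (hlim : Tendsto w (cocompact ℂ) (𝓝 0)) : w = 0 := by
  have hwd : Differentiable ℝ w := hw.differentiable (by simp)
  -- triangularity: `S ξ (w ξ) = S ξ (0, (w ξ).2)`, so `∂̄ w = -½ S ξ (0, (w ξ).2)`
  have hcomp : ∀ ξ, dbarAlong (1 : ℂ) w ξ = -((2 : ℂ)⁻¹ • S ξ (0, (w ξ).2)) := fun ξ => by
    have h := heq ξ
    rw [apply_eq_apply_zero_snd (S ξ) (htri ξ) (w ξ)] at h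
    exact eq_neg_half_smul h
  have hSv : ContDiff ℝ ∞ fun ξ => S ξ (0, (w ξ).2) :=
    hSs.clm_apply (contDiff_const.prodMk hw.snd)
  -- the second component: `∂̄ w₂ = r₂`, `‖r₂‖ ≤ (M/2) ‖w₂‖`, `r₂ = 0` far out, `w₂ → 0`
  set w₂ : ℂ → ℂ := fun ξ => (w ξ).2 with hw₂_def
  set r₂ : ℂ → ℂ := fun ξ => -((2 : ℂ)⁻¹ * (S ξ (0, (w ξ).2)).2) with hr₂_def
  have hw₂ : ContDiff ℝ ∞ w₂ := hw.snd
  have hr₂ : ContDiff ℝ ∞ r₂ := (contDiff_const.mul hSv.snd).neg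
  have hdbar₂ : ∀ ξ, dbarAlong (1 : ℂ) w₂ ξ = r₂ ξ := fun ξ => by
    rw [hw₂_def, ← snd_dbarAlong (hwd ξ), hcomp ξ]
    simp [hr₂_def]
  have hM₂ : ∀ ξ, ‖r₂ ξ‖ ≤ M / 2 * ‖w₂ ξ‖ := fun ξ => by
    have h1 : ‖(S ξ (0, (w ξ).2)).2‖ ≤ M * ‖(w ξ).2‖ :=
      calc ‖(S ξ (0, (w ξ).2)).2‖ ≤ ‖S ξ (0, (w ξ).2)‖ := norm_snd_le _
        _ ≤ ‖S ξ‖ * ‖((0 : ℂ), (w ξ).2)‖ := (S ξ).le_opNorm _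
        _ ≤ M * ‖(w ξ).2‖ := by
            rw [norm_zero_mk]
            exact mul_le_mul_of_nonneg_right (hM ξ) (norm_nonneg _)
    have h2 : ‖r₂ ξ‖ = 2⁻¹ * ‖(S ξ (0, (w ξ).2)).2‖ := by
      rw [hr₂_def, norm_neg, norm_mul, norm_inv, Complex.norm_two]
    rw [h2]
    show 2⁻¹ * ‖(S ξ (0, (w ξ).2)).2‖ ≤ M / 2 * ‖(w ξ).2‖
    linarith
  have hsupp₂ : ∀ ξ, ρ ≤ ‖ξ‖ → r₂ ξ = 0 := fun ξ hξ => by simp [hr₂_def, hS ξ hξ]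
  have hlim₂ : Tendsto w₂ (cocompact ℂ) (𝓝 0) := by
    have h := (continuous_snd.tendsto (0 : ℂ × ℂ)).comp hlim
    rw [Prod.snd_zero] at h
    exact h
  have hw₂0 : w₂ = 0 :=
    eq_zero_of_dbar_le_of_tendsto_zero w₂ r₂ (M / 2) ρ hw₂ hr₂ hdbar₂ hM₂ hsupp₂ hlim₂
  have hw₂0' : ∀ ξ, (w ξ).2 = 0 := fun ξ => by simpa using congrFun hw₂0 ξ
  -- the first component: `∂̄ w₁ = 0`, `w₁ → 0`
  set w₁ : ℂ → ℂ := fun ξ => (w ξ).1 with hw₁_def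
  have hw₁ : ContDiff ℝ ∞ w₁ := hw.fst
  have hdbar₁ : ∀ ξ, dbarAlong (1 : ℂ) w₁ ξ = (fun _ : ℂ => (0 : ℂ)) ξ := fun ξ => by
    rw [hw₁_def, ← fst_dbarAlong (hwd ξ), hcomp ξ, hw₂0' ξ, Prod.mk_zero_zero, map_zero,
      smul_zero, neg_zero, Prod.fst_zero]
  have hlim₁ : Tendsto w₁ (cocompact ℂ) (𝓝 0) := by
    have h := (continuous_fst.tendsto (0 : ℂ × ℂ)).comp hlim
    rw [Prod.fst_zero] at h
    exact h
  have hw₁0 : w₁ = 0 :=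
    eq_zero_of_dbar_le_of_tendsto_zero w₁ (fun _ => 0) 0 ρ hw₁ contDiff_const hdbar₁
      (fun ξ => by simp) (fun _ _ => rfl) hlim₁
  funext ξ
  exact Prod.ext (by simpa using congrFun hw₁0 ξ) (by simpa using congrFun hw₂0 ξ)

end Summit.SmoothPoincare4.SmoothPoincare4.Cruxes.TameOrBrodyR4.Sketch

end
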